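import Mathlib
import Summits.ResolutionOfSingularities.ResolutionOfSingularities.Theorems.RisoStrataDefs
import Literature.AlgebraicGeometry.Resolution.LocalBlowup

/-!
# Route RisoStrata — crux `RisoCentresResolve` (stmt-ResolutionOfSingularities-18546), line `Sketch`:
# plumbing of the riso tower (local rings at a centre, charts, stages)

Elementary lemmas about the objects of `RisoStrataDefs.lean` (generic in the cut predicate `P`),
used by every stub of the line:

* `risoLoc` versus the tree's `locAtCentre` (`LocalBlowup.lean`): for `B ⊆ O`,
  `(risoLoc O B).toSubring = locAtCentre B.toSubring O` (`risoLoc_toSubring_eq`), hence `risoLoc` is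
  monotone, idempotent, lies in `O`, is closed under inverting units of `O`, satisfies the sandwich
  rule `B ≤ B' ≤ risoLoc O B ⇒ risoLoc O B' = risoLoc O B`, and its regularity is that of the
  localisation `B_{𝔪_O ∩ B}` (`isRegularLocalRing_risoLoc_iff`);
* charts: `B ≤ risoStep P B d x`, an admissible chart lies in `O`, a chart whose denominator is a
  unit of `O` lies in `risoLoc O B`, and charts of finitely generated algebras are finitely
  generated (`risoStep_fg`);
* stages: the successor formula `risoStage_succ`, monotonicity, `≤ O` along admissible denominators,
  finite generation, and independence of the part of the schedule beyond `t` (`risoStage_take`);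
* the initial charts `k[hᵢ/hⱼ]`, `k[hᵢ/hⱼ']` of one presentation containing the centre of `O` have
  the same local ring there (`risoLoc_chart_eq`).

No definitions, no named facts.
-/

noncomputable section

set_option linter.dupNamespace false -- mandated namespace of this single-conjunct summit

namespace Summit.ResolutionOfSingularities.ResolutionOfSingularities.Theorems

open Literature.AlgebraicGeometry.Resolution

variable {k K : Type} [Field k] [Field K] [Algebra k K]

/-! ## `risoLoc` and `locAtCentre` -/

section Loc

variable (O : ValuationSubring K)

/-- `B ⊆ risoLoc O B` (`b = b · 1⁻¹`). [folklore] -/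
theorem le_risoLoc (B : Subalgebra k K) : B ≤ risoLoc O B := fun b hb =>
  Algebra.subset_adjoin ⟨b, hb, 1, B.one_mem, by simp, by simp⟩

/-- `risoLoc` is monotone in the subalgebra. [folklore] -/
theorem risoLoc_mono {B B' : Subalgebra k K} (h : B ≤ B') : risoLoc O B ≤ risoLoc O B' := by
  refine Algebra.adjoin_mono ?_
  rintro y ⟨a, ha, s, hs, hsO, rfl⟩
  exact ⟨a, h ha, s, h hs, hsO, rfl⟩

variable {O}

/-- A scalar lies in `O` as soon as some `k`-subalgebra does. [folklore] -/
theorem algebraMap_mem_of_toSubring_le {B : Subalgebra k K} (hBO : B.toSubring ≤ O.toSubring)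
    (c : k) : algebraMap k K c ∈ O :=
  hBO (B.algebraMap_mem c)

/-- For `s ∈ O` with `s⁻¹ ∈ O` and `s ≠ 0`, the value of `s` is `1`. [folklore] -/
theorem valuation_eq_one_of_mem_of_inv_mem {s : K} (hs : s ∈ O) (hsO : s⁻¹ ∈ O) (hs0 : s ≠ 0) :
    O.valuation s = 1 := by
  apply le_antisymm ((O.valuation_le_one_iff s).mpr hs)
  have h1 : (O.valuation s)⁻¹ ≤ 1 := by
    rw [← map_inv₀]; exact (O.valuation_le_one_iff _).mpr hsO
  have hv0 : 0 < O.valuation s := by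
    rw [pos_iff_ne_zero]; simpa using hs0
  exact (inv_le_one₀ hv0).mp h1

/-- **`risoLoc` is `locAtCentre`**: for a `k`-subalgebra `B ⊆ O` of `K`, the subalgebra
`risoLoc O B = k[{a s⁻¹ | a, s ∈ B, s⁻¹ ∈ O}]` has underlying subring
`locAtCentre B O = {y / z | y, z ∈ B, ν(z) = 0}`. [folklore] -/
theorem risoLoc_toSubring_eq {B : Subalgebra k K} (hBO : B.toSubring ≤ O.toSubring) :
    (risoLoc O B).toSubring = locAtCentre B.toSubring O := by
  -- `locAtCentre` as a `k`-subalgebra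
  let L : Subalgebra k K :=
    { locAtCentre B.toSubring O with
      algebraMap_mem' := fun c => le_locAtCentre B.toSubring O (B.algebraMap_mem c) }
  have hL : L.toSubring = locAtCentre B.toSubring O := rfl
  suffices h : risoLoc O B = L by rw [h]
  apply le_antisymm
  · refine Algebra.adjoin_le ?_
    rintro y ⟨a, ha, s, hs, hsO, rfl⟩
    change a * s⁻¹ ∈ locAtCentre B.toSubring O
    by_cases hs0 : s = 0
    · rw [hs0, inv_zero, mul_zero]; exact Subring.zero_mem _
    · have hv : O.valuation s = 1 := valuation_eq_one_of_mem_of_inv_mem (hBO hs) hsO hs0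
      exact ⟨a, ha, s, hs, hv, by rw [div_eq_mul_inv]⟩
  · intro y hy
    obtain ⟨a, ha, s, hs, hv, rfl⟩ := (mem_locAtCentre_iff).mp hy
    refine Algebra.subset_adjoin ⟨a, ha, s, hs, ?_, by rw [div_eq_mul_inv]⟩
    rw [← O.valuation_le_one_iff, map_inv₀, hv, inv_one]

/-- `risoLoc O B ⊆ O` for `B ⊆ O`. [folklore] -/
theorem risoLoc_toSubring_le {B : Subalgebra k K} (hBO : B.toSubring ≤ O.toSubring) :
    (risoLoc O B).toSubring ≤ O.toSubring := by
  rw [risoLoc_toSubring_eq hBO]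
  exact locAtCentre_le hBO

/-- An element of `risoLoc O B` (`B ⊆ O`) whose inverse lies in `O` has its inverse in
`risoLoc O B`. [folklore] -/
theorem inv_mem_risoLoc {B : Subalgebra k K} (hBO : B.toSubring ≤ O.toSubring) {x : K}
    (hx : x ∈ risoLoc O B) (hxO : x⁻¹ ∈ O) : x⁻¹ ∈ risoLoc O B := by
  by_cases hx0 : x = 0
  · rw [hx0, inv_zero]; exact Subalgebra.zero_mem _
  have hx' : x ∈ (risoLoc O B).toSubring := hx
  rw [risoLoc_toSubring_eq hBO] at hx'
  have hv : O.valuation x = 1 :=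
    valuation_eq_one_of_mem_of_inv_mem (locAtCentre_le hBO hx') hxO hx0
  have : x⁻¹ ∈ (risoLoc O B).toSubring := by
    rw [risoLoc_toSubring_eq hBO]; exact inv_mem_locAtCentre hx' hv
  exact this

/-- Idempotence: `risoLoc O (risoLoc O B) = risoLoc O B` (`B ⊆ O`). [folklore] -/
theorem risoLoc_risoLoc {B : Subalgebra k K} (hBO : B.toSubring ≤ O.toSubring) :
    risoLoc O (risoLoc O B) = risoLoc O B := by
  apply Subalgebra.toSubring_injective
  rw [risoLoc_toSubring_eq (risoLoc_toSubring_le hBO), risoLoc_toSubring_eq hBO,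
    locAtCentre_locAtCentre]

/-- **Sandwich rule**: `B ≤ B' ≤ risoLoc O B` forces `risoLoc O B' = risoLoc O B` (`B ⊆ O`).
[folklore] -/
theorem risoLoc_eq_of_le_of_le {B B' : Subalgebra k K} (hBO : B.toSubring ≤ O.toSubring)
    (h₁ : B ≤ B') (h₂ : B' ≤ risoLoc O B) : risoLoc O B' = risoLoc O B :=
  le_antisymm ((risoLoc_mono O h₂).trans (risoLoc_risoLoc hBO).le) (risoLoc_mono O h₁)

/-- **Regularity of `risoLoc O B` is regularity of `B` localised at the centre `𝔪_O ∩ B`**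
(`B ⊆ O`): the rings `risoLoc O B` and `locAtCentre B O` coincide. [folklore] -/
theorem isRegularLocalRing_risoLoc_iff {B : Subalgebra k K} (hBO : B.toSubring ≤ O.toSubring) :
    IsRegularLocalRing ↥(risoLoc O B) ↔
      IsRegularLocalRing (Localization.AtPrime (subringCentre B.toSubring O hBO)) := by
  rw [← isRegularLocalRing_locAtCentre_iff hBO]
  have hmem : ∀ x : K, x ∈ risoLoc O B ↔ x ∈ locAtCentre B.toSubring O := fun x => by
    rw [← risoLoc_toSubring_eq hBO]; rfl
  let e : ↥(risoLoc O B) ≃+* locAtCentre B.toSubring O :=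
    { toFun := fun x => ⟨x.1, (hmem x.1).mp x.2⟩
      invFun := fun x => ⟨x.1, (hmem x.1).mpr x.2⟩
      left_inv := fun _ => rfl
      right_inv := fun _ => rfl
      map_mul' := fun _ _ => rfl
      map_add' := fun _ _ => rfl }
  exact ⟨fun _ => IsRegularLocalRing.of_ringEquiv e, fun _ => IsRegularLocalRing.of_ringEquiv e.symm⟩

end Loc

/-! ## Charts -/

section Step

variable (P : ∀ B : Subalgebra k K, Ideal ↥B → ℕ → Prop)

/-- `B ⊆ step B d x`. [folklore] -/
theorem le_risoStep (B : Subalgebra k K) (d : ℕ) (xt : K) : B ≤ risoStep P B d xt :=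
  fun _ hb => Algebra.subset_adjoin (Set.mem_union_left _ hb)

/-- The new generators `a · x⁻¹`, `a ∈ Cen`, lie in the chart. [folklore] -/
theorem mul_inv_mem_risoStep {B : Subalgebra k K} {d : ℕ} {xt : K} {a : ↥B}
    (ha : a ∈ risoCen P B d) : (a : K) * xt⁻¹ ∈ risoStep P B d xt :=
  Algebra.subset_adjoin (Set.mem_union_right _ ⟨a, ha, rfl⟩)

variable {P}

/-- An ADMISSIBLE chart lies in `O`: if `B ⊆ O` and `Cen · x⁻¹ ⊆ O` then `step B d x ⊆ O`.
[folklore] -/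
theorem risoStep_toSubring_le {O : ValuationSubring K} {B : Subalgebra k K}
    (hBO : B.toSubring ≤ O.toSubring) {d : ℕ} {xt : K} (hV : risoValid P O B d xt) :
    (risoStep P B d xt).toSubring ≤ O.toSubring := by
  let Oₖ : Subalgebra k K :=
    { O.toSubring with algebraMap_mem' := fun c => algebraMap_mem_of_toSubring_le hBO c }
  have h : risoStep P B d xt ≤ Oₖ := by
    refine Algebra.adjoin_le ?_
    rintro y (hy | ⟨a, ha, rfl⟩)
    · exact hBO hy
    · exact hV.2.2 a ha
  exact fun y hy => h hy

/-- A chart whose denominator `x ∈ B` is a unit of `O` lies in the local ring of `B` at the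
centre of `O`. [folklore] -/
theorem risoStep_le_risoLoc (O : ValuationSubring K) {B : Subalgebra k K} {d : ℕ} {xt : K}
    (hxt : xt ∈ B) (hxtO : xt⁻¹ ∈ O) : risoStep P B d xt ≤ risoLoc O B := by
  refine Algebra.adjoin_le ?_
  rintro y (hy | ⟨a, _, rfl⟩)
  · exact le_risoLoc O B hy
  · exact Algebra.subset_adjoin ⟨a, a.2, xt, hxt, hxtO, rfl⟩

/-- A finitely generated `k`-subalgebra of `K` is a Noetherian ring. [folklore] -/
theorem isNoetherianRing_of_fg {B : Subalgebra k K} (hB : B.FG) : IsNoetherianRing ↥B := by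
  haveI : Algebra.FiniteType k ↥B := (Subalgebra.fg_iff_finiteType B).mp hB
  exact Algebra.FiniteType.isNoetherianRing k ↥B

/-- **Charts of finitely generated algebras are finitely generated**: if `B = k[t]` and the
centre ideal is generated by `c₁, …, c_r`, then `step B d x = k[t, c₁ x⁻¹, …, c_r x⁻¹]`.
[folklore] -/
theorem risoStep_fg {B : Subalgebra k K} (hB : B.FG) (d : ℕ) (xt : K) :
    (risoStep P B d xt).FG := by
  classical
  haveI := isNoetherianRing_of_fg hB
  obtain ⟨tB, htB⟩ := hB
  obtain ⟨c, hc⟩ := (IsNoetherian.noetherian (risoCen P B d) : (risoCen P B d).FG)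
  refine ⟨tB ∪ c.image (fun a : ↥B => (a : K) * xt⁻¹), ?_⟩
  rw [Finset.coe_union, Finset.coe_image]
  apply le_antisymm
  · refine Algebra.adjoin_le ?_
    rintro y (hy | ⟨a, ha, rfl⟩)
    · exact le_risoStep P B d xt (htB ▸ Algebra.subset_adjoin hy)
    · exact mul_inv_mem_risoStep P (hc ▸ Ideal.subset_span ha)
  · refine Algebra.adjoin_le ?_
    rintro y (hy | ⟨a, ha, rfl⟩)
    · have hy' : y ∈ Algebra.adjoin k (tB : Set K) := by rw [htB]; exact hy
      exact Algebra.adjoin_mono Set.subset_union_left hy'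
    · -- `a = ∑ bᵢ cᵢ`
      have ha' : a ∈ Submodule.span ↥B (c : Set ↥B) := by rw [← hc] at ha; exact ha
      rw [Submodule.mem_span_finset] at ha'
      obtain ⟨f, -, hf⟩ := ha'
      rw [← hf, AddSubmonoidClass.coe_finsetSum, Finset.sum_mul]
      refine Subalgebra.sum_mem _ fun i hi => ?_
      rw [smul_eq_mul, MulMemClass.coe_mul, mul_assoc]
      refine Subalgebra.mul_mem _ ?_ ?_
      · have : ((f i : ↥B) : K) ∈ Algebra.adjoin k (tB : Set K) := by
          rw [htB]; exact (f i).2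
        exact Algebra.adjoin_mono Set.subset_union_left this
      · exact Algebra.subset_adjoin (Set.mem_union_right _ ⟨i, hi, rfl⟩)

end Step

/-! ## Stages of the tower -/

section Stage

variable (P : ∀ B : Subalgebra k K, Ideal ↥B → ℕ → Prop) (B₀ : Subalgebra k K)
  (sched : List ℕ) (x : ℕ → K)

/-- **Successor formula**: for `t < |sched|`,
`stage (t+1) = step (stage t) (sched[t]) (x t)`. [folklore] -/
theorem risoStage_succ {t : ℕ} (ht : t < sched.length) :
    risoStage P B₀ sched x (t + 1) =
      risoStep P (risoStage P B₀ sched x t) (sched.getD t 0) (x t) := by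
  unfold risoStage
  rw [List.take_add_one, List.zipIdx_append, List.foldl_append, List.getElem?_eq_getElem ht,
    Option.toList_some, List.zipIdx_singleton, List.foldl_cons, List.foldl_nil, List.length_take,
    Nat.min_eq_left ht.le, Nat.zero_add, List.getD_eq_getElem?_getD, List.getElem?_eq_getElem ht,
    Option.getD_some]

/-- Beyond the end of the schedule the tower is constant. [folklore] -/
theorem risoStage_eq_of_length_le {t : ℕ} (ht : sched.length ≤ t) :
    risoStage P B₀ sched x t = risoStage P B₀ sched x sched.length := by
  unfold risoStage
  rw [List.take_of_length_le ht, List.take_length]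

/-- The tower only reads the first `t` letters of the schedule up to stage `t`. [folklore] -/
theorem risoStage_take {t t' : ℕ} (h : t ≤ t') :
    risoStage P B₀ (sched.take t') x t = risoStage P B₀ sched x t := by
  unfold risoStage
  rw [List.take_take, Nat.min_eq_left h]

/-- The tower increases: `stage t ≤ stage (t+1)`. [folklore] -/
theorem risoStage_le_succ (t : ℕ) :
    risoStage P B₀ sched x t ≤ risoStage P B₀ sched x (t + 1) := by
  by_cases ht : t < sched.length
  · rw [risoStage_succ P B₀ sched x ht]
    exact le_risoStep P _ _ _
  · rw [not_lt] at ht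
    rw [risoStage_eq_of_length_le P B₀ sched x ht,
      risoStage_eq_of_length_le P B₀ sched x (ht.trans (Nat.le_succ t))]

/-- The tower increases: `stage s ≤ stage t` for `s ≤ t`. [folklore] -/
theorem risoStage_mono {s t : ℕ} (hst : s ≤ t) :
    risoStage P B₀ sched x s ≤ risoStage P B₀ sched x t := by
  induction hst with
  | refl => exact le_rfl
  | step _ ih => exact ih.trans (risoStage_le_succ P B₀ sched x _)

/-- `B₀ ≤ stage t`. [folklore] -/
theorem le_risoStage (t : ℕ) : B₀ ≤ risoStage P B₀ sched x t := by
  have := risoStage_mono P B₀ sched x (Nat.zero_le t)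
  rwa [risoStage_zero] at this

variable {P B₀ sched x}

/-- **Admissible towers stay inside `O`**: if `B₀ ⊆ O` and the denominators are admissible at
every stage `< t`, then `stage t ⊆ O`. [folklore] -/
theorem risoStage_toSubring_le {O : ValuationSubring K} (hB₀ : B₀.toSubring ≤ O.toSubring)
    {t : ℕ} (hadm : ∀ s, s < t → s < sched.length →
      risoValid P O (risoStage P B₀ sched x s) (sched.getD s 0) (x s)) :
    (risoStage P B₀ sched x t).toSubring ≤ O.toSubring := by
  induction t with
  | zero => rwa [risoStage_zero]
  | succ t ih =>
    have ih' := ih (fun s hs hs' => hadm s (Nat.lt_succ_of_lt hs) hs')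
    by_cases ht : t < sched.length
    · rw [risoStage_succ P B₀ sched x ht]
      exact risoStep_toSubring_le ih' (hadm t (Nat.lt_succ_self t) ht)
    · rw [not_lt] at ht
      rw [risoStage_eq_of_length_le P B₀ sched x (ht.trans (Nat.le_succ t))]
      rwa [risoStage_eq_of_length_le P B₀ sched x ht] at ih'

/-- **Stages of a finitely generated start are finitely generated.** [folklore] -/
theorem risoStage_fg (hB₀ : B₀.FG) (t : ℕ) : (risoStage P B₀ sched x t).FG := by
  induction t with
  | zero => rwa [risoStage_zero]
  | succ t ih =>
    by_cases ht : t < sched.length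
    · rw [risoStage_succ P B₀ sched x ht]
      exact risoStep_fg ih _ _
    · rw [not_lt] at ht
      rw [risoStage_eq_of_length_le P B₀ sched x (ht.trans (Nat.le_succ t))]
      rwa [risoStage_eq_of_length_le P B₀ sched x ht] at ih

end Stage

/-! ## The initial charts of a presentation share their local ring at the centre -/

section Chart

/-- If every ratio `hᵢ/hⱼ` lies in `O ⊇ k`, the chart `k[hᵢ/hⱼ : i]` lies in `O`. [folklore] -/
theorem chart_toSubring_le {O : ValuationSubring K} (hk : ∀ c : k, algebraMap k K c ∈ O)
    {N : ℕ} (h : Fin (N + 1) → K) (j : Fin (N + 1)) (hj : ∀ i, h i * (h j)⁻¹ ∈ O) :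
    (Algebra.adjoin k (Set.range fun i => h i * (h j)⁻¹)).toSubring ≤ O.toSubring := by
  let Oₖ : Subalgebra k K := { O.toSubring with algebraMap_mem' := hk }
  have : Algebra.adjoin k (Set.range fun i => h i * (h j)⁻¹) ≤ Oₖ :=
    Algebra.adjoin_le (by rintro _ ⟨i, rfl⟩; exact hj i)
  exact fun y hy => this hy

/-- **Chart independence at the start**: two charts `k[hᵢ/hⱼ]`, `k[hᵢ/hⱼ']` of the same
presentation that both contain the centre of `O` (i.e. lie in `O`) have the same local ring at the
centre of `O`: `hⱼ'/hⱼ` is a unit of `O` lying in the first chart, with inverse in the second.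
[folklore] -/
theorem risoLoc_chart_eq {O : ValuationSubring K} (hk : ∀ c : k, algebraMap k K c ∈ O)
    {N : ℕ} (h : Fin (N + 1) → K) (hh : ∀ i, h i ≠ 0) (j j' : Fin (N + 1))
    (hj : ∀ i, h i * (h j)⁻¹ ∈ O) (hj' : ∀ i, h i * (h j')⁻¹ ∈ O) :
    risoLoc O (Algebra.adjoin k (Set.range fun i => h i * (h j)⁻¹)) =
      risoLoc O (Algebra.adjoin k (Set.range fun i => h i * (h j')⁻¹)) := by
  -- one inclusion suffices, by symmetry
  suffices key : ∀ j j' : Fin (N + 1), (∀ i, h i * (h j)⁻¹ ∈ O) → (∀ i, h i * (h j')⁻¹ ∈ O) →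
      Algebra.adjoin k (Set.range fun i => h i * (h j')⁻¹) ≤
        risoLoc O (Algebra.adjoin k (Set.range fun i => h i * (h j)⁻¹)) by
    apply le_antisymm
    · have := risoLoc_mono O (key j' j hj' hj)
      rwa [risoLoc_risoLoc (chart_toSubring_le hk h j' hj')] at this
    · have := risoLoc_mono O (key j j' hj hj')
      rwa [risoLoc_risoLoc (chart_toSubring_le hk h j hj)] at this
  intro j j' hj hj'
  refine Algebra.adjoin_le ?_
  rintro _ ⟨i, rfl⟩
  -- `hᵢ/hⱼ' = (hᵢ/hⱼ) · (hⱼ'/hⱼ)⁻¹`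
  have hmem : ∀ i, h i * (h j)⁻¹ ∈ Algebra.adjoin k (Set.range fun i => h i * (h j)⁻¹) :=
    fun i => Algebra.subset_adjoin ⟨i, rfl⟩
  refine Algebra.subset_adjoin ⟨h i * (h j)⁻¹, hmem i, h j' * (h j)⁻¹, hmem j', ?_, ?_⟩
  · have : (h j' * (h j)⁻¹)⁻¹ = h j * (h j')⁻¹ := by
      rw [mul_inv, inv_inv, mul_comm]
    rw [this]; exact hj' j
  · field_simp [hh j, hh j']

end Chart

end Summit.ResolutionOfSingularities.ResolutionOfSingularities.Theorems

end
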